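import Summits.CriticalPhenomena.PercolationContinuityZ3.Theorems.Transplant.FKConnectivityAllQAntipodalRootFormSteps

/-!
# Connectivity correlation inequalities for `φ_{w,q}`, every `q > 0` — ROOT-FORM CALCULUS, file 61q: TRANSFER of the five facts along a
# reindexing of configurations with a constant level shift

Support file (`--supports stmt-CriticalPhenomena-4575`), FK sub-lane `prim-bschramm-fk-2` (gen 29); builds on p205010 (kernel theorem,
internal audit signed; external expert review pending).  No definitions, no named facts, no sorries; standard axioms.  Memo
FROM-fk-2-g28-ROOT-FORM.md §7 (L4d); FK-Q2 §38.

The real environment of `f·𝓔` / `g ∥ 𝓔` (a fresh series / parallel free edge) is the abstract `serE` / `parE` of the real environment of `𝓔`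
after reindexing the configurations along an order-preserving equivalence (`Bool × ↥M.powerset ≃ ↥(insert f M).powerset`) and shifting every
level by a constant (the fresh vertex / the closed cycle).  This file proves, abstractly, that the five facts of the word theorem
(`FK.RootForm.spine_facts`: nested root functional, its parallel transform, deleted / contracted / free-nested AND) are invariant under such a
transfer: `integrands_of_addLam` (a constant level shift moves the level argument of every integrand), `transfer_Mt`, `transfer_parE`,
`transfer_andDel`, `transfer_andCon`, `transfer_andFree`.  Pure finite bookkeeping.
[folklore]
-/

noncomputable section

namespace Summit.CriticalPhenomena.PercolationContinuityZ3.Theorems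

namespace FK

namespace RootForm

open Finset

section Shift

/-- A constant level shift `κ` of the four pattern data moves the level argument of all six integrands by `−κ`. [folklore] -/
theorem integrands_of_addLam (e e' : EDat) (κ : ℤ) (h0 : e'.d0 = ⟨e.d0.lam + κ, e.d0.k1, e.d0.k2⟩)
    (hy : e'.dy = ⟨e.dy.lam + κ, e.dy.k1, e.dy.k2⟩) (hz : e'.dz = ⟨e.dz.lam + κ, e.dz.k1, e.dz.k2⟩)
    (hyz : e'.dyz = ⟨e.dyz.lam + κ, e.dyz.k1, e.dyz.k2⟩) (J : ℤ) :
    e'.slot1 J = e.slot1 (J - κ) ∧ e'.slot0 J = e.slot0 (J - κ) ∧ e'.andDel J = e.andDel (J - κ) ∧ e'.andCon J = e.andCon (J - κ) ∧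
      e'.andE1 J = e.andE1 (J - κ) ∧ e'.andE2 J = e.andE2 (J - κ) := by
  have a1 : ∀ d : PDat, PDat.a1 ⟨d.lam + κ, d.k1, d.k2⟩ J = d.a1 (J - κ) := fun d => ind_congr (by simp only; omega)
  have a2 : ∀ d : PDat, PDat.a2 ⟨d.lam + κ, d.k1, d.k2⟩ J = d.a2 (J - κ) := fun d => ind_congr (by simp only; omega)
  have ad : ∀ d : PDat, PDat.adel ⟨d.lam + κ, d.k1, d.k2⟩ J = d.adel (J - κ) := fun d => ind_congr (by simp only; omega)
  have ac : ∀ d : PDat, PDat.acon ⟨d.lam + κ, d.k1, d.k2⟩ J = d.acon (J - κ) := fun d => ind_congr (by simp only; omega)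
  have r1 : ∀ d : PDat, PDat.r1 ⟨d.lam + κ, d.k1, d.k2⟩ J = d.r1 (J - κ) := fun d =>
    ind_congr (by simp only; constructor <;> rintro ⟨h, h'⟩ <;> exact ⟨by omega, h'⟩)
  have r2 : ∀ d : PDat, PDat.r2 ⟨d.lam + κ, d.k1, d.k2⟩ J = d.r2 (J - κ) := fun d =>
    ind_congr (by simp only; constructor <;> rintro ⟨h, h'⟩ <;> exact ⟨by omega, h'⟩)
  simp only [EDat.slot1, EDat.slot0, EDat.andDel, EDat.andCon, EDat.andE1, EDat.andE2, h0, hy, hz, hyz, a1, a2, ad, ac, r1, r2, and_self]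

/-- A parallel free edge commutes with a constant level shift. [folklore] -/
theorem par_addLam (d : PDat) (κ : ℤ) (b : Bool) :
    PDat.par b ⟨d.lam + κ, d.k1, d.k2⟩ = ⟨(d.par b).lam + κ, (d.par b).k1, (d.par b).k2⟩ := by
  simp only [PDat.par, PDat.mk.injEq, and_true]; ring

/-- A series free edge commutes with a constant level shift. [folklore] -/
theorem ser_addLam (d : PDat) (κ : ℤ) (b : Bool) :
    PDat.ser b ⟨d.lam + κ, d.k1, d.k2⟩ = ⟨(d.ser b).lam + κ, (d.ser b).k1, (d.ser b).k2⟩ := by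
  simp only [PDat.ser]

end Shift

section Transfer

variable {C C' : Type*} [Fintype C] [Fintype C'] [Preorder C] [Preorder C'] {E : Env C} {E' : Env C'} {φ : C ≃ C'} {κ : ℤ}

/-- **Fact 1 transfers**: if `E' ∘ φ` has the integrands of `E` at the level shifted by `κ` and `φ` is monotone, then `M̃_E ≥ 0` (against every
monotone nested nonnegative weight pair) implies `M̃_{E'} ≥ 0`. [folklore] -/
theorem transfer_Mt (hφ : Monotone φ)
    (hs : ∀ p J, (E' (φ p)).slot1 J = (E p).slot1 (J - κ) ∧ (E' (φ p)).slot0 J = (E p).slot0 (J - κ))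
    (hM : ∀ h0 h1 : C → ℝ, Monotone h0 → Monotone h1 → (∀ γ, 0 ≤ h0 γ) → (∀ γ, h0 γ ≤ h1 γ) → ∀ J : ℤ, 0 ≤ Mt E h0 h1 J)
    (H0 H1 : C' → ℝ) (m0 : Monotone H0) (m1 : Monotone H1) (n0 : ∀ γ, 0 ≤ H0 γ) (le : ∀ γ, H0 γ ≤ H1 γ) (J : ℤ) :
    0 ≤ Mt E' H0 H1 J := by
  have key := hM (H0 ∘ φ) (H1 ∘ φ) (m0.comp hφ) (m1.comp hφ) (fun γ => n0 _) (fun γ => le _) (J - κ)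
  unfold Mt at key ⊢
  rw [← Equiv.sum_comp φ]
  refine key.trans_eq (Finset.sum_congr rfl fun p _ => ?_)
  obtain ⟨h1, h0⟩ := hs p J
  simp only [Function.comp_apply, h1, h0]

omit [Fintype C] [Fintype C'] [Preorder C] [Preorder C'] in
/-- The parallel transform of a transferred environment is the transfer of the parallel transform. [folklore] -/
theorem transfer_parE_hs (hd : ∀ p, E' (φ p) = ⟨⟨(E p).d0.lam + κ, (E p).d0.k1, (E p).d0.k2⟩, ⟨(E p).dy.lam + κ, (E p).dy.k1, (E p).dy.k2⟩,
      ⟨(E p).dz.lam + κ, (E p).dz.k1, (E p).dz.k2⟩, ⟨(E p).dyz.lam + κ, (E p).dyz.k1, (E p).dyz.k2⟩⟩) (q : Bool × C) (J : ℤ) :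
    (parE E' ((Equiv.prodCongr (Equiv.refl Bool) φ) q)).slot1 J = (parE E q).slot1 (J - κ) ∧
      (parE E' ((Equiv.prodCongr (Equiv.refl Bool) φ) q)).slot0 J = (parE E q).slot0 (J - κ) := by
  obtain ⟨b, p⟩ := q
  have h := integrands_of_addLam (parE E (b, p)) (parE E' (b, φ p)) κ
    (by simp only [parE, EDat.par, hd, par_addLam]) (by simp only [parE, EDat.par, hd, par_addLam])
    (by simp only [parE, EDat.par, hd, par_addLam]) (by simp only [parE, EDat.par, hd, par_addLam]) J
  exact ⟨h.1, h.2.1⟩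

omit [Fintype C] [Fintype C'] [Preorder C] [Preorder C'] in
/-- All six integrands of a transferred environment. [folklore] -/
theorem transfer_hs (hd : ∀ p, E' (φ p) = ⟨⟨(E p).d0.lam + κ, (E p).d0.k1, (E p).d0.k2⟩, ⟨(E p).dy.lam + κ, (E p).dy.k1, (E p).dy.k2⟩,
      ⟨(E p).dz.lam + κ, (E p).dz.k1, (E p).dz.k2⟩, ⟨(E p).dyz.lam + κ, (E p).dyz.k1, (E p).dyz.k2⟩⟩) (p : C) (J : ℤ) :
    (E' (φ p)).slot1 J = (E p).slot1 (J - κ) ∧ (E' (φ p)).slot0 J = (E p).slot0 (J - κ) ∧ (E' (φ p)).andDel J = (E p).andDel (J - κ) ∧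
      (E' (φ p)).andCon J = (E p).andCon (J - κ) ∧ (E' (φ p)).andE1 J = (E p).andE1 (J - κ) ∧ (E' (φ p)).andE2 J = (E p).andE2 (J - κ) :=
  integrands_of_addLam (E p) (E' (φ p)) κ (by rw [hd]) (by rw [hd]) (by rw [hd]) (by rw [hd]) J

omit [Fintype C] [Fintype C'] in
/-- `prodCongr (refl Bool) φ` is monotone when `φ` is. [folklore] -/
theorem mono_prodCongr (hφ : Monotone φ) : Monotone (Equiv.prodCongr (Equiv.refl Bool) φ) := fun _ _ hpq =>
  Prod.mk_le_mk.2 ⟨(Prod.mk_le_mk.1 hpq).1, hφ (Prod.mk_le_mk.1 hpq).2⟩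

/-- **Fact 2 transfers.** [folklore] -/
theorem transfer_parE (hφ : Monotone φ)
    (hd : ∀ p, E' (φ p) = ⟨⟨(E p).d0.lam + κ, (E p).d0.k1, (E p).d0.k2⟩, ⟨(E p).dy.lam + κ, (E p).dy.k1, (E p).dy.k2⟩,
      ⟨(E p).dz.lam + κ, (E p).dz.k1, (E p).dz.k2⟩, ⟨(E p).dyz.lam + κ, (E p).dyz.k1, (E p).dyz.k2⟩⟩)
    (hP : ∀ h0 h1 : Bool × C → ℝ, Monotone h0 → Monotone h1 → (∀ p, 0 ≤ h0 p) → (∀ p, h0 p ≤ h1 p) → ∀ J : ℤ, 0 ≤ Mt (parE E) h0 h1 J)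
    (H0 H1 : Bool × C' → ℝ) (m0 : Monotone H0) (m1 : Monotone H1) (n0 : ∀ q, 0 ≤ H0 q) (le : ∀ q, H0 q ≤ H1 q) (J : ℤ) :
    0 ≤ Mt (parE E') H0 H1 J :=
  transfer_Mt (E := parE E) (E' := parE E') (φ := Equiv.prodCongr (Equiv.refl Bool) φ) (κ := κ) (mono_prodCongr hφ)
    (fun q J => transfer_parE_hs hd q J) hP H0 H1 m0 m1 n0 le J

/-- **Facts 3/4 transfer** (single weight, deleted / contracted AND). [folklore] -/
theorem transfer_single (hφ : Monotone φ) {I : EDat → ℤ → ℝ} (hs : ∀ p J, I (E' (φ p)) J = I (E p) (J - κ))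
    (hI : ∀ h : C → ℝ, Monotone h → (∀ γ, 0 ≤ h γ) → ∀ J : ℤ, 0 ≤ ∑ γ, h γ * I (E γ) J)
    (H : C' → ℝ) (mH : Monotone H) (nH : ∀ γ, 0 ≤ H γ) (J : ℤ) : 0 ≤ ∑ γ, H γ * I (E' γ) J := by
  have key := hI (H ∘ φ) (mH.comp hφ) (fun γ => nH _) (J - κ)
  rw [← Equiv.sum_comp φ]
  refine key.trans_eq (Finset.sum_congr rfl fun p _ => ?_)
  simp only [Function.comp_apply, hs]

/-- **Fact 5 transfers** (nested free AND). [folklore] -/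
theorem transfer_andFree (hφ : Monotone φ)
    (hs : ∀ p J, (E' (φ p)).andE1 J = (E p).andE1 (J - κ) ∧ (E' (φ p)).andE2 J = (E p).andE2 (J - κ))
    (hf : ∀ h0 h1 : C → ℝ, Monotone h0 → Monotone h1 → (∀ γ, 0 ≤ h0 γ) → (∀ γ, h0 γ ≤ h1 γ) → ∀ J : ℤ,
      0 ≤ ∑ γ, (h1 γ * (E γ).andE1 J + h0 γ * (E γ).andE2 J))
    (H0 H1 : C' → ℝ) (m0 : Monotone H0) (m1 : Monotone H1) (n0 : ∀ γ, 0 ≤ H0 γ) (le : ∀ γ, H0 γ ≤ H1 γ) (J : ℤ) :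
    0 ≤ ∑ γ, (H1 γ * (E' γ).andE1 J + H0 γ * (E' γ).andE2 J) := by
  have key := hf (H0 ∘ φ) (H1 ∘ φ) (m0.comp hφ) (m1.comp hφ) (fun γ => n0 _) (fun γ => le _) (J - κ)
  rw [← Equiv.sum_comp φ]
  refine key.trans_eq (Finset.sum_congr rfl fun p _ => ?_)
  obtain ⟨h1, h0⟩ := hs p J
  simp only [Function.comp_apply, h1, h0]

/-- **All five facts transfer** along a monotone reindexing with a constant level shift. [folklore] -/
theorem transfer_facts (hφ : Monotone φ)
    (hd : ∀ p, E' (φ p) = ⟨⟨(E p).d0.lam + κ, (E p).d0.k1, (E p).d0.k2⟩, ⟨(E p).dy.lam + κ, (E p).dy.k1, (E p).dy.k2⟩,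
      ⟨(E p).dz.lam + κ, (E p).dz.k1, (E p).dz.k2⟩, ⟨(E p).dyz.lam + κ, (E p).dyz.k1, (E p).dyz.k2⟩⟩)
    (h5 : (∀ h0 h1 : C → ℝ, Monotone h0 → Monotone h1 → (∀ γ, 0 ≤ h0 γ) → (∀ γ, h0 γ ≤ h1 γ) → ∀ J : ℤ, 0 ≤ Mt E h0 h1 J)
      ∧ (∀ h0 h1 : Bool × C → ℝ, Monotone h0 → Monotone h1 → (∀ p, 0 ≤ h0 p) → (∀ p, h0 p ≤ h1 p) → ∀ J : ℤ, 0 ≤ Mt (parE E) h0 h1 J)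
      ∧ (∀ h : C → ℝ, Monotone h → (∀ γ, 0 ≤ h γ) → ∀ J : ℤ, 0 ≤ ∑ γ, h γ * (E γ).andDel J)
      ∧ (∀ h : C → ℝ, Monotone h → (∀ γ, 0 ≤ h γ) → ∀ J : ℤ, 0 ≤ ∑ γ, h γ * (E γ).andCon J)
      ∧ (∀ h0 h1 : C → ℝ, Monotone h0 → Monotone h1 → (∀ γ, 0 ≤ h0 γ) → (∀ γ, h0 γ ≤ h1 γ) → ∀ J : ℤ,
          0 ≤ ∑ γ, (h1 γ * (E γ).andE1 J + h0 γ * (E γ).andE2 J))) :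
    (∀ h0 h1 : C' → ℝ, Monotone h0 → Monotone h1 → (∀ γ, 0 ≤ h0 γ) → (∀ γ, h0 γ ≤ h1 γ) → ∀ J : ℤ, 0 ≤ Mt E' h0 h1 J)
      ∧ (∀ h0 h1 : Bool × C' → ℝ, Monotone h0 → Monotone h1 → (∀ p, 0 ≤ h0 p) → (∀ p, h0 p ≤ h1 p) → ∀ J : ℤ, 0 ≤ Mt (parE E') h0 h1 J)
      ∧ (∀ h : C' → ℝ, Monotone h → (∀ γ, 0 ≤ h γ) → ∀ J : ℤ, 0 ≤ ∑ γ, h γ * (E' γ).andDel J)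
      ∧ (∀ h : C' → ℝ, Monotone h → (∀ γ, 0 ≤ h γ) → ∀ J : ℤ, 0 ≤ ∑ γ, h γ * (E' γ).andCon J)
      ∧ (∀ h0 h1 : C' → ℝ, Monotone h0 → Monotone h1 → (∀ γ, 0 ≤ h0 γ) → (∀ γ, h0 γ ≤ h1 γ) → ∀ J : ℤ,
          0 ≤ ∑ γ, (h1 γ * (E' γ).andE1 J + h0 γ * (E' γ).andE2 J)) := by
  obtain ⟨f1, f2, f3, f4, f5⟩ := h5
  refine ⟨?_, ?_, ?_, ?_, ?_⟩
  · exact fun H0 H1 m0 m1 n0 le J => transfer_Mt hφ (fun p J => ⟨(transfer_hs hd p J).1, (transfer_hs hd p J).2.1⟩) f1 H0 H1 m0 m1 n0 le J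
  · exact fun H0 H1 m0 m1 n0 le J => transfer_parE hφ hd f2 H0 H1 m0 m1 n0 le J
  · exact fun H mH nH J => transfer_single hφ (I := fun e J => e.andDel J) (fun p J => (transfer_hs hd p J).2.2.1) f3 H mH nH J
  · exact fun H mH nH J => transfer_single hφ (I := fun e J => e.andCon J) (fun p J => (transfer_hs hd p J).2.2.2.1) f4 H mH nH J
  · exact fun H0 H1 m0 m1 n0 le J =>
      transfer_andFree hφ (fun p J => ⟨(transfer_hs hd p J).2.2.2.2.1, (transfer_hs hd p J).2.2.2.2.2⟩) f5 H0 H1 m0 m1 n0 le J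

end Transfer

end RootForm

end FK

end Summit.CriticalPhenomena.PercolationContinuityZ3.Theorems

end
-- build-touch 2026-08-25T05:00Z T1 (lead g17): re-land of p377651, declarations byte-identical
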